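import Mathlib
import Literature.Analysis.SpecialFunctions.BesselHeatKernelDuhamelOperator
import Literature.Analysis.SpecialFunctions.BesselHeatKernelDuhamel
import HarnessLib

/-!
# The Neumann (Duhamel perturbation) series of the radial heat kernels in the index

For the radial heat kernels `q^{(κ)}_t(x,y) = t⁻¹ e^{-(x²+y²)/2t} I_κ(xy/t)` (`BesselHeatKernel.lean`), `u_κ := κ²/2`, and the Volterra
operator `T_ν = q^{(ν)} V ∗ ·` of `BesselHeatKernelDuhamelOperator.lean`, iterating the one-step Duhamel identity
`Q_μ = Q_ν + (u_ν - u_μ) T_ν Q_μ` (`0 ≤ μ ≤ ν`; `heatKernelENN_eq_add_duhamelOp`, from `besselHeatKernel_sub_eq_integral`) gives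

* the comparison `q^{(ν)} ≤ q^{(μ)}` for `μ ≤ ν` (`besselHeatKernel_antitone_index` — no order-monotonicity of `I_κ` is used);
* the expansion with nonnegative remainder `Q_μ = Σ_{j<J} (u_ν-u_μ)^j T_ν^j Q_ν + (u_ν-u_μ)^J T_ν^J Q_μ`
  (`heatKernelENN_eq_sum_add_remainder`);
* the bound `Σ_j u_ν^j (T_ν^j Q_ν)(t,x) ≤ Q_0(t,x) < ∞` (`tsum_neumannTerm_le`) — radius of convergence `≥ u_ν`;
* the IDENTIFICATION `Q_μ = Σ_j (u_ν-u_μ)^j T_ν^j Q_ν` whenever `0 < μ ≤ ν` and `u_ν - u_μ ≤ u_μ` (`heatKernelENN_eq_tsum`): the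
  remainder is `≤ u_μ^J T_μ^J Q_μ → 0` by the previous two items applied at base `μ`;
* the real-variable interface `exists_hasSum_besselHeatKernel_index` : for `ν > 0`, `t, x, y > 0` there are `m_j ≥ 0` with
  `Σ m_j u_ν^j < ∞` and `q^{(√(2u))}_t(x,y) = Σ_j m_j (u_ν - u)^j` for all `u ∈ [u_ν/2, u_ν]`.

The last item says that `u ↦ q^{(√(2u))}_t(x,y)` — i.e. `u ↦ I_{√(2u)}(xy/t)` up to a positive factor — is LOCALLY a power
series in `(U - u)` with nonnegative coefficients around every `u > 0`; this is the analytic heart of the Hartman–Watson theorem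
(complete monotonicity of `u ↦ I_{√(2u)}(r)`, [HartmanWatson1974; Yor1980]) in the Feynman–Kac/Duhamel form of
[RevuzYor1999, Ch. XI §1].

## References
* D. Revuz, M. Yor, *Continuous Martingales and Brownian Motion*, 3rd ed. (1999), Ch. XI §1. [RevuzYor1999]
* P. Hartman, G. S. Watson, Ann. Probab. 2 (1974) 593–607. [HartmanWatson1974]
-/

noncomputable section

open Filter Topology Real MeasureTheory Set Function
open scoped NNReal ENNReal BigOperators

namespace Literature.Analysis.SpecialFunctions

section DuhamelENN

variable {μ ν y : ℝ}

/-- **Comparison of indices**: `q^{(ν)}_t(x,y) ≤ q^{(μ)}_t(x,y)` for `0 ≤ μ ≤ ν` (the Duhamel correction is nonnegative).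
[cite: RevuzYor1999, Ch. XI §1] -/
theorem besselHeatKernel_antitone_index (hμ : 0 ≤ μ) (hμν : μ ≤ ν) {t x : ℝ} (ht : 0 < t) (hx : 0 < x) (hy : 0 < y) :
    besselHeatKernel ν t x y ≤ besselHeatKernel μ t x y := by
  rcases eq_or_lt_of_le hμν with h | h
  · rw [h]
  · have hν : 0 ≤ ν := hμ.trans hμν
    have hI := (integrableOn_duhamelDensity hμ h ht hx hy).2
    have hc : 0 < (ν ^ 2 - μ ^ 2) / 2 := by nlinarith
    have hnn : 0 ≤ ∫ s in Ioo (0 : ℝ) t, ∫ z in Ioi (0 : ℝ),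
        besselHeatKernel ν (t - s) x z * besselHeatKernel μ s y z / z :=
      setIntegral_nonneg measurableSet_Ioo fun s hs => duhamelDensity_nonneg hμ hν hx hy hs.1 hs.2
    rw [hI] at hnn
    have := (div_nonneg_iff.1 hnn)
    rcases this with ⟨h1, -⟩ | ⟨-, h2⟩
    · linarith
    · linarith

/-- **The one-step Duhamel identity in `ℝ≥0∞` form**: `Q_μ = Q_ν + (u_ν - u_μ) · T_ν Q_μ` pointwise, for `0 ≤ μ ≤ ν`,
`μ + ν > 0`, `y > 0`. [cite: RevuzYor1999, Ch. XI §1] -/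
theorem heatKernelENN_eq_add_duhamelOp (hμ : 0 ≤ μ) (hμν : μ ≤ ν) (hpos : 0 < μ + ν) (hy : 0 < y) (t x : ℝ) :
    heatKernelENN μ y t x =
      heatKernelENN ν y t x + ENNReal.ofReal ((ν ^ 2 - μ ^ 2) / 2) * duhamelOp ν (heatKernelENN μ y) t x := by
  have hν : 0 ≤ ν := hμ.trans hμν
  by_cases hq : 0 < t ∧ 0 < x
  · obtain ⟨ht, hx⟩ := hq
    rw [heatKernelENN_of_pos ht hx, heatKernelENN_of_pos ht hx, duhamelOp_eq_lintegral_Ioo]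
    -- the inner integrals
    have hinner : ∀ s ∈ Ioo (0 : ℝ) t,
        (∫⁻ z in Ioi (0 : ℝ), duhamelWeight ν t x s z * heatKernelENN μ y s z) =
          ENNReal.ofReal (∫ z in Ioi (0 : ℝ), besselHeatKernel ν (t - s) x z * besselHeatKernel μ s y z / z) := by
      intro s hs
      have hint := integrableOn_besselHeatKernel_mul_div hμ hν hpos (τ := t - s) (s := s) (by linarith [hs.2]) hs.1 hx hy
      rw [ofReal_integral_eq_lintegral_ofReal hint (ae_restrict_of_forall_mem measurableSet_Ioi fun z hz =>
        div_nonneg (mul_nonneg (besselHeatKernel_pos hν (by linarith [hs.2]) hx hz).le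
          (besselHeatKernel_pos hμ hs.1 hy hz).le) (le_of_lt hz))]
      refine setLIntegral_congr_fun measurableSet_Ioi fun z hz => ?_
      have hz' : (0 : ℝ) < z := hz
      rw [duhamelWeight_of_pos hs.2 hx, heatKernelENN_of_pos hs.1 hz', ← ENNReal.ofReal_mul
        (div_nonneg (besselHeatKernel_pos hν (by linarith [hs.2]) hx hz').le hz'.le), besselHeatKernel_symm μ s z y]
      congr 1
      ring
    rw [setLIntegral_congr_fun measurableSet_Ioo hinner]
    rcases eq_or_lt_of_le hμν with h | h
    · subst h
      simp
    · have hc : 0 < (ν ^ 2 - μ ^ 2) / 2 := by nlinarith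
      obtain ⟨hE, hI⟩ := integrableOn_duhamelDensity hμ h ht hx hy
      rw [← ofReal_integral_eq_lintegral_ofReal hE (ae_restrict_of_forall_mem measurableSet_Ioo fun s hs =>
        duhamelDensity_nonneg hμ hν hx hy hs.1 hs.2), hI, ← ENNReal.ofReal_mul hc.le,
        mul_div_cancel₀ _ hc.ne', ← ENNReal.ofReal_add (besselHeatKernel_pos hν ht hx hy).le
          (sub_nonneg.2 (besselHeatKernel_antitone_index hμ hμν ht hx hy)), add_sub_cancel]
  · rw [heatKernelENN_of_not hq, heatKernelENN_of_not hq, duhamelOp_of_not _ hq, mul_zero, add_zero]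

end DuhamelENN

/-! ## The expansion with remainder and the Neumann series -/

section Neumann

variable {μ ν y : ℝ}

/-- **Duhamel expansion with nonnegative remainder**:
`Q_μ = Σ_{j<J} c^j T_ν^j Q_ν + c^J T_ν^J Q_μ`, `c = u_ν - u_μ = (ν²-μ²)/2`, for `0 ≤ μ ≤ ν`, `μ + ν > 0`.
[cite: RevuzYor1999, Ch. XI §1] -/
theorem heatKernelENN_eq_sum_add_remainder (hμ : 0 ≤ μ) (hμν : μ ≤ ν) (hpos : 0 < μ + ν) (hy : 0 < y) (J : ℕ)
    (t x : ℝ) :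
    heatKernelENN μ y t x =
      (∑ j ∈ Finset.range J, ENNReal.ofReal ((ν ^ 2 - μ ^ 2) / 2) ^ j * (duhamelOp ν)^[j] (heatKernelENN ν y) t x)
        + ENNReal.ofReal ((ν ^ 2 - μ ^ 2) / 2) ^ J * (duhamelOp ν)^[J] (heatKernelENN μ y) t x := by
  have hν : 0 ≤ ν := hμ.trans hμν
  set c : ℝ≥0∞ := ENNReal.ofReal ((ν ^ 2 - μ ^ 2) / 2) with hc
  have hc' : c ≠ ∞ := ENNReal.ofReal_ne_top
  -- the identity as an equality of functions
  have hfun : heatKernelENN μ y = heatKernelENN ν y + fun s z => c * duhamelOp ν (heatKernelENN μ y) s z := by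
    funext s z
    exact heatKernelENN_eq_add_duhamelOp hμ hμν hpos hy s z
  induction J generalizing t x with
  | zero => simp
  | succ J ih =>
    rw [Finset.sum_range_succ, ih t x, add_assoc]
    congr 1
    -- `c^J T^J Q_μ = c^J T^J Q_ν + c^{J+1} T^{J+1} Q_μ`
    have h1 : (duhamelOp ν)^[J] (heatKernelENN μ y) t x =
        (duhamelOp ν)^[J] (heatKernelENN ν y) t x + c * (duhamelOp ν)^[J + 1] (heatKernelENN μ y) t x := by
      conv_lhs => rw [hfun]
      rw [duhamelOp_iterate_add hν (measurable_heatKernelENN hν y), duhamelOp_iterate_const_mul hc',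
        Function.iterate_succ_apply]
    rw [h1, mul_add, pow_succ]
    ring

/-- **Radius of convergence**: `Σ_j u_ν^j (T_ν^j Q_ν)(t,x) ≤ Q_0(t,x)` for `ν > 0` (`u_ν = ν²/2`). [cite: RevuzYor1999, Ch. XI §1] -/
theorem tsum_neumannTerm_le (hν : 0 < ν) (hy : 0 < y) (t x : ℝ) :
    ∑' j, ENNReal.ofReal (ν ^ 2 / 2) ^ j * (duhamelOp ν)^[j] (heatKernelENN ν y) t x ≤ heatKernelENN 0 y t x := by
  rw [ENNReal.tsum_eq_iSup_nat]
  refine iSup_le fun J => ?_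
  have h := heatKernelENN_eq_sum_add_remainder (μ := 0) (ν := ν) le_rfl hν.le (by linarith) hy J t x
  have h0 : (ν ^ 2 - 0 ^ 2) / 2 = ν ^ 2 / 2 := by ring
  rw [h0] at h
  rw [h]
  exact le_self_add

/-- The Neumann terms are finite: `(T_ν^j Q_ν)(t,x) < ∞` (`ν > 0`). [cite: RevuzYor1999, Ch. XI §1] -/
theorem neumannTerm_lt_top (hν : 0 < ν) (hy : 0 < y) (j : ℕ) (t x : ℝ) :
    (duhamelOp ν)^[j] (heatKernelENN ν y) t x < ∞ := by
  have h1 : ENNReal.ofReal (ν ^ 2 / 2) ^ j * (duhamelOp ν)^[j] (heatKernelENN ν y) t x < ∞ :=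
    lt_of_le_of_lt ((ENNReal.le_tsum j).trans (tsum_neumannTerm_le hν hy t x)) (heatKernelENN_lt_top t x)
  have h2 : ENNReal.ofReal (ν ^ 2 / 2) ^ j ≠ 0 :=
    pow_ne_zero _ ((ENNReal.ofReal_pos.2 (by positivity)).ne')
  exact lt_top_iff_ne_top.2 fun h => (lt_top_iff_ne_top.1 h1) (by rw [h]; exact ENNReal.mul_top h2)

/-- **Identification of the Neumann series**: for `0 < μ ≤ ν` with `u_ν - u_μ ≤ u_μ`,
`Q_μ(t,x) = Σ_j (u_ν-u_μ)^j (T_ν^j Q_ν)(t,x)` — the remainder `c^J T_ν^J Q_μ ≤ u_μ^J T_μ^J Q_μ` tends to `0`.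
[cite: RevuzYor1999, Ch. XI §1] -/
theorem heatKernelENN_eq_tsum (hμ : 0 < μ) (hμν : μ ≤ ν) (hcu : (ν ^ 2 - μ ^ 2) / 2 ≤ μ ^ 2 / 2) (hy : 0 < y)
    (t x : ℝ) :
    heatKernelENN μ y t x =
      ∑' j, ENNReal.ofReal ((ν ^ 2 - μ ^ 2) / 2) ^ j * (duhamelOp ν)^[j] (heatKernelENN ν y) t x := by
  set c : ℝ≥0∞ := ENNReal.ofReal ((ν ^ 2 - μ ^ 2) / 2) with hc
  set S : ℕ → ℝ≥0∞ := fun J => ∑ j ∈ Finset.range J, c ^ j * (duhamelOp ν)^[j] (heatKernelENN ν y) t x with hS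
  set a : ℕ → ℝ≥0∞ := fun J => ENNReal.ofReal (μ ^ 2 / 2) ^ J * (duhamelOp μ)^[J] (heatKernelENN μ y) t x with ha
  have hexp : ∀ J, heatKernelENN μ y t x = S J + c ^ J * (duhamelOp ν)^[J] (heatKernelENN μ y) t x := fun J =>
    heatKernelENN_eq_sum_add_remainder hμ.le hμν (by linarith) hy J t x
  -- the remainder bound `c^J T_ν^J Q_μ ≤ a_J`
  have hrem : ∀ J, c ^ J * (duhamelOp ν)^[J] (heatKernelENN μ y) t x ≤ a J := by
    intro J
    refine mul_le_mul' (pow_le_pow_left' (ENNReal.ofReal_le_ofReal hcu) J) ?_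
    exact duhamelOp_iterate_mono_weight
      (fun τ x' z hτ hx' hz => besselHeatKernel_antitone_index hμ.le hμν hτ hx' hz) J t x
  -- `a_J → 0`: the terms of a convergent series
  have hsum : ∑' J, a J ≠ ∞ :=
    (lt_of_le_of_lt (tsum_neumannTerm_le hμ hy t x) (heatKernelENN_lt_top t x)).ne
  have ha0 : Tendsto a atTop (𝓝 0) := ENNReal.tendsto_atTop_zero_of_tsum_ne_top hsum
  -- conclude
  rw [ENNReal.tsum_eq_iSup_nat]
  refine le_antisymm ?_ (iSup_le fun J => by rw [hexp J]; exact le_self_add)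
  have hle : ∀ J, heatKernelENN μ y t x ≤ (⨆ J, S J) + a J := fun J => by
    rw [hexp J]
    exact add_le_add (le_iSup S J) (hrem J)
  have hlim : Tendsto (fun J => (⨆ J, S J) + a J) atTop (𝓝 ((⨆ J, S J) + 0)) :=
    tendsto_const_nhds.add ha0
  rw [add_zero] at hlim
  exact ge_of_tendsto' hlim hle

end Neumann

/-! ## The real-variable interface: a local power series in the index variable `u = κ²/2` -/

section RealSeries

variable {ν t x y : ℝ}

/-- **Local power series of `u ↦ q^{(√(2u))}_t(x,y)` with nonnegative coefficients**: for `ν > 0` and `t, x, y > 0` there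
are `m_j ≥ 0` (namely `m_j = (T_ν^j Q_ν)(t,x)`) with `Σ_j m_j u_ν^j < ∞` (`u_ν = ν²/2`) and
`q^{(√(2u))}_t(x,y) = Σ_j m_j (u_ν - u)^j` for every `u ∈ [u_ν/2, u_ν]`. [cite: RevuzYor1999, Ch. XI §1] -/
theorem exists_hasSum_besselHeatKernel_index (hν : 0 < ν) (ht : 0 < t) (hx : 0 < x) (hy : 0 < y) :
    ∃ m : ℕ → ℝ, (∀ j, 0 ≤ m j) ∧ Summable (fun j => m j * (ν ^ 2 / 2) ^ j) ∧
      (∑' j, m j * (ν ^ 2 / 2) ^ j) ≤ besselHeatKernel 0 t x y ∧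
      ∀ u : ℝ, ν ^ 2 / 4 ≤ u → u ≤ ν ^ 2 / 2 →
        HasSum (fun j => m j * (ν ^ 2 / 2 - u) ^ j) (besselHeatKernel (Real.sqrt (2 * u)) t x y) := by
  set M : ℕ → ℝ≥0∞ := fun j => (duhamelOp ν)^[j] (heatKernelENN ν y) t x with hM
  have hMtop : ∀ j, M j ≠ ∞ := fun j => (neumannTerm_lt_top hν hy j t x).ne
  refine ⟨fun j => (M j).toReal, fun j => ENNReal.toReal_nonneg, ?_, ?_, ?_⟩
  · -- summability at radius `u_ν`
    have h := tsum_neumannTerm_le hν hy t x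
    have hne : ∑' j, ENNReal.ofReal (ν ^ 2 / 2) ^ j * M j ≠ ∞ := (lt_of_le_of_lt h (heatKernelENN_lt_top t x)).ne
    have hs := ENNReal.summable_toReal hne
    refine hs.congr fun j => ?_
    rw [ENNReal.toReal_mul, ENNReal.toReal_pow, ENNReal.toReal_ofReal (by positivity), mul_comm]
  · have h := tsum_neumannTerm_le hν hy t x
    have hne : ∑' j, ENNReal.ofReal (ν ^ 2 / 2) ^ j * M j ≠ ∞ := (lt_of_le_of_lt h (heatKernelENN_lt_top t x)).ne
    have h1 : (∑' j, (M j).toReal * (ν ^ 2 / 2) ^ j) = (∑' j, ENNReal.ofReal (ν ^ 2 / 2) ^ j * M j).toReal := by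
      rw [ENNReal.tsum_toReal_eq fun j => ENNReal.mul_ne_top (ENNReal.pow_ne_top ENNReal.ofReal_ne_top) (hMtop j)]
      refine tsum_congr fun j => ?_
      rw [ENNReal.toReal_mul, ENNReal.toReal_pow, ENNReal.toReal_ofReal (by positivity), mul_comm]
    rw [h1, ← ENNReal.toReal_ofReal (besselHeatKernel_pos le_rfl ht hx hy).le]
    refine ENNReal.toReal_mono ENNReal.ofReal_ne_top (h.trans (le_of_eq ?_))
    rw [heatKernelENN_of_pos ht hx]
  · intro u hu1 hu2
    have hu0 : 0 < u := lt_of_lt_of_le (by positivity) hu1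
    set μ : ℝ := Real.sqrt (2 * u) with hμdef
    have hμ0 : 0 < μ := Real.sqrt_pos.2 (by positivity)
    have hμsq : μ ^ 2 = 2 * u := Real.sq_sqrt (by positivity)
    have hμν : μ ≤ ν := by
      rw [hμdef, ← Real.sqrt_sq hν.le]
      exact Real.sqrt_le_sqrt (by nlinarith)
    have hcu : (ν ^ 2 - μ ^ 2) / 2 ≤ μ ^ 2 / 2 := by rw [hμsq]; linarith
    have hcu' : (ν ^ 2 - μ ^ 2) / 2 = ν ^ 2 / 2 - u := by rw [hμsq]; ring
    have hid := heatKernelENN_eq_tsum hμ0 hμν hcu hy t x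
    rw [heatKernelENN_of_pos ht hx, hcu'] at hid
    have hc0 : 0 ≤ ν ^ 2 / 2 - u := by linarith
    have hterm : ∀ j, ENNReal.ofReal (ν ^ 2 / 2 - u) ^ j * M j ≠ ∞ := fun j =>
      ENNReal.mul_ne_top (ENNReal.pow_ne_top ENNReal.ofReal_ne_top) (hMtop j)
    have hne : ∑' j, ENNReal.ofReal (ν ^ 2 / 2 - u) ^ j * M j ≠ ∞ := by rw [← hid]; exact ENNReal.ofReal_ne_top
    have hs := ENNReal.summable_toReal hne
    have hs' : Summable fun j => (M j).toReal * (ν ^ 2 / 2 - u) ^ j := by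
      refine hs.congr fun j => ?_
      rw [ENNReal.toReal_mul, ENNReal.toReal_pow, ENNReal.toReal_ofReal hc0, mul_comm]
    have hval : (∑' j, (M j).toReal * (ν ^ 2 / 2 - u) ^ j) = besselHeatKernel μ t x y := by
      have h1 : (∑' j, (M j).toReal * (ν ^ 2 / 2 - u) ^ j) =
          (∑' j, ENNReal.ofReal (ν ^ 2 / 2 - u) ^ j * M j).toReal := by
        rw [ENNReal.tsum_toReal_eq hterm]
        refine tsum_congr fun j => ?_
        rw [ENNReal.toReal_mul, ENNReal.toReal_pow, ENNReal.toReal_ofReal hc0, mul_comm]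
      rw [h1, ← hid, ENNReal.toReal_ofReal (besselHeatKernel_pos hμ0.le ht hx hy).le]
    rw [← hval]
    exact hs'.hasSum

end RealSeries

end Literature.Analysis.SpecialFunctions

end
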